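import Mathlib
import Summits.Ventures.PercRepro2.Defs
import Summits.Ventures.PercRepro2.Graph
import Summits.Ventures.PercRepro2.OneColourSwitch
import Summits.Ventures.PercRepro2.RegionHubSign
import Summits.Ventures.PercRepro2.SideSwitch
import Summits.Ventures.PercRepro2.SideSwitchFibre
import Summits.Ventures.PercRepro2.SideSwitchClosed
import Summits.Ventures.PercRepro2.SideSwitchComps
import Summits.Ventures.PercRepro2.SideSwitchCompsFibre
import Summits.Ventures.PercRepro2.M9NoPocketDefs
import Summits.Ventures.PercRepro2.M9NoPocketWorld
import Summits.Ventures.PercRepro2.M9NoPocketWorldD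
import Summits.Ventures.PercRepro2.M9NoPocketMono
import Summits.Ventures.PercRepro2.M9NoPocketCompl
import Summits.Ventures.PercRepro2.M9DAvoid
import Summits.Ventures.PercRepro2.M9RegionSplit
import Summits.Ventures.PercRepro2.M9PocketCubeDefs
import Summits.Ventures.PercRepro2.M9PocketCubeMono
import Summits.Ventures.PercRepro2.M9PocketCubeHub

/-!
# The block-group cube WITH a pocket — the worlds of `d` and `r ~ s` along the cube (blind cell
PercRepro2, p3 g23, 2026-08-28; `proofs/P3-HARRIS.md` §3)

The first-edge decomposition of a connection to `d` (`conn_d_decomp`: a `Y`-path from `a ≠ d` to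
`d` leaves `d` by a `Y`-edge `d–u` with `a ~ u` in `G − d`), the transfer of `G − d` connections
inside the worlds (`conn_endsD_assignX_anti_of_mem_K2`: inside the `Y`-world of the larger
assignment the `Y`-connections survive downwards; `conn_endsD_compl_assignX_mono_of_mem_M2`: the
mirror), and the monotonicity table for the terminals: `d ∈ K₂` decreases
(`mem_K2_assignX_anti`), `d ∈ M₂` increases (`mem_M2_assignX_mono`), `r ~_Y s` decreases
(`conn_rs_assignX_anti'`), `r ~_W s` increases (`conn_rs_compl_assignX_mono'`).  Own work; std
axioms.
-/

namespace Summit.Ventures.PercRepro2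

namespace NoPocket

open Finset Classical RegionHub OneColourSwitch SideSwitch

variable {V : Type*} {E : Type*}

section Decomp

variable {ends : E → Sym2 V}

/-- **First-edge decomposition**: a connection from `a ≠ d` to `d` leaves `d` by an open edge
`d–u` whose other end is connected to `a` in `G − d`. -/
lemma conn_d_decomp {d : V} {ω : Config E} {a : V} (had : a ≠ d) (hc : Conn ends ω a d) :
    ∃ e u, ends e = s(d, u) ∧ ω e = true ∧ Conn (endsD ends d) ω a u := by
  by_contra hno
  push Not at hno
  have key : d ∈ {x | Conn (endsD ends d) ω a x} := by
    refine mem_of_conn_of_closed (ends := ends) (ω := ω) ?_ (conn_refl _ _ _) hc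
    intro x hx y hxy
    obtain ⟨hne, e, he, hends⟩ := openGraph_adj.1 hxy
    have hxd : x ≠ d := ne_d_of_conn_endsD had hx
    have hyd : y ≠ d := by
      rintro rfl
      exact hno e x (by rw [hends, Sym2.eq_swap]) he hx
    have hd : d ∉ ends e := notMem_of_ends_ne hends hxd hyd
    exact conn_trans hx (conn_of_openAdj ⟨e, he, by rw [endsD_of_notMem hd, hends]⟩)
  exact (ne_d_of_conn_endsD had key) rfl

end Decomp

section WorldMono

variable [Fintype V] [DecidableEq V] [Fintype E] [DecidableEq E]

variable {ends : E → Sym2 V}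

/-- A vertex of the `Y`-world of `G − d` of an assignment is not a pocket vertex. -/
lemma not_mem_Oprime_of_mem_K2_endsD_assignX {p q r s d : V} (hr : d ≠ r) (hs : d ≠ s)
    {ρ : Config E} (hρ : ρ ∈ RepD ends p q r s d) {x : Finset (Finset V) × Finset E}
    (hT : x.1 ⊆ blocks ends d r s ρ) (hF : x.2 ⊆ freeE ends d r s ρ) {y : V}
    (hy : y ∈ K2 (endsD ends d) r s (assignX ends x ρ)) : y ∉ Oprime ends d r s ρ := by
  intro hO
  rw [K2_endsD_assignX' hr hs hρ hT hF] at hy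
  exact (mem_Oprime.1 hO).1 hy.1

/-- A vertex of the `W`-world of `G − d` of an assignment is not a pocket vertex. -/
lemma not_mem_Oprime_of_mem_M2_endsD_assignX {p q r s d : V} (hr : d ≠ r) (hs : d ≠ s)
    {ρ : Config E} (hρ : ρ ∈ RepD ends p q r s d) {x : Finset (Finset V) × Finset E}
    (hT : x.1 ⊆ blocks ends d r s ρ) (hF : x.2 ⊆ freeE ends d r s ρ) {y : V}
    (hy : y ∈ M2 (endsD ends d) r s (assignX ends x ρ)) : y ∉ Oprime ends d r s ρ := by
  intro hO
  rw [M2_endsD_assignX' hr hs hρ hT hF] at hy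
  rcases hy with hy | hy
  · exact (mem_Oprime.1 hO).2 hy
  · have hyA := unionT_subset_A0 (ends := endsD ends d) hT (Finset.mem_coe.1 hy)
    obtain ⟨hU, _, _⟩ := mem_A0.1 hyA
    exact hU.elim (mem_Oprime.1 hO).1 (mem_Oprime.1 hO).2

omit [Fintype V] in
/-- A free edge with both ends outside the pocket is not in any `x.2`. -/
lemma not_mem_snd_of_notMem_Oprime {r s d : V} {ρ : Config E}
    {x : Finset (Finset V) × Finset E} (hF : x.2 ⊆ freeE ends d r s ρ) {e : E} {y z : V}
    (hends : ends e = s(y, z)) (hyd : y ≠ d) (hzd : z ≠ d) (hyO : y ∉ Oprime ends d r s ρ) :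
    e ∉ x.2 := by
  intro hx
  have hd : d ∉ ends e := notMem_of_ends_ne hends hyd hzd
  have hP := mem_Pk_of_mem_freeE_of_notMem_d (hF hx) hd
  obtain ⟨a, ha, b, hb, hab⟩ := mem_Pk.1 hP
  rw [hends, Sym2.eq_iff] at hab
  rcases hab with ⟨h1, _⟩ | ⟨h1, _⟩
  · rw [← h1] at ha; exact hyO ha
  · rw [← h1] at hb; exact hyO hb

/-- An assignment has no doubly reached vertex in `G − d` other than `r, s`. -/
lemma DZero_endsD_assignX' {p q r s d : V} (hr : d ≠ r) (hs : d ≠ s) {ρ : Config E}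
    (hρ : ρ ∈ RepD ends p q r s d) {x : Finset (Finset V) × Finset E}
    (hT : x.1 ⊆ blocks ends d r s ρ) (hF : x.2 ⊆ freeE ends d r s ρ) :
    DZero (endsD ends d) r s (assignX ends x ρ) := by
  intro y hyr hys hK hM
  rw [K2_endsD_assignX' hr hs hρ hT hF] at hK
  rw [M2_endsD_assignX' hr hs hρ hT hF] at hM
  obtain ⟨_, hM', _⟩ := mem_RepD.1 hρ
  rcases hM with hyM | hyT
  · rcases hM' y hyM with rfl | rfl
    · exact hyr rfl
    · exact hys rfl
  · exact hK.2 hyT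

/-- **Inside the `Y`-world of `G − d` of the larger assignment, `Y`-connections survive
downwards.** -/
theorem conn_endsD_assignX_anti_of_mem_K2 {p q r s d : V} (hr : d ≠ r) (hs : d ≠ s)
    {ρ : Config E} (hρ : ρ ∈ RepD ends p q r s d) {x x' : Finset (Finset V) × Finset E}
    (hxx' : x ≤ x') (hx : x ∈ cubeP ends d r s ρ) (hx' : x' ∈ cubeP ends d r s ρ) {a b : V}
    (ha : a ∈ K2 (endsD ends d) r s (assignX ends x' ρ))
    (hc : Conn (endsD ends d) (assignX ends x' ρ) a b) :
    Conn (endsD ends d) (assignX ends x ρ) a b := by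
  obtain ⟨_, hF⟩ := mem_cubeP.1 hx
  obtain ⟨hT', hF'⟩ := mem_cubeP.1 hx'
  refine conn_endsD_of_le_within_cluster ?_ hc
  intro e y z hends hyz hyd hzd hay haz hopen
  have hyK : y ∈ K2 (endsD ends d) r s (assignX ends x' ρ) := by
    rcases mem_K2_iff.1 ha with h | h
    · exact mem_K2_iff.2 (Or.inl (conn_trans h hay))
    · exact mem_K2_iff.2 (Or.inr (conn_trans h hay))
  have hzK : z ∈ K2 (endsD ends d) r s (assignX ends x' ρ) := by
    rcases mem_K2_iff.1 ha with h | h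
    · exact mem_K2_iff.2 (Or.inl (conn_trans h haz))
    · exact mem_K2_iff.2 (Or.inr (conn_trans h haz))
  rw [K2_endsD_assignX' hr hs hρ hT' hF'] at hyK hzK
  rw [assignX_eq_of_le hxx' hT' ?_ ?_]
  · exact hopen
  · rintro ⟨w, hw, v, hwv⟩
    rw [hends, Sym2.eq_iff] at hwv
    rcases hwv with ⟨h1, _⟩ | ⟨_, h2⟩
    · rw [← h1] at hw
      exact hyK.2 (Finset.mem_coe.2 (Finset.mem_sdiff.1 (Finset.mem_coe.1 hw)).1)
    · rw [← h2] at hw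
      exact hzK.2 (Finset.mem_coe.2 (Finset.mem_sdiff.1 (Finset.mem_coe.1 hw)).1)
  · intro heF
    have hyO : y ∉ Oprime ends d r s ρ := fun hO => (mem_Oprime.1 hO).1 hyK.1
    exact not_mem_snd_of_notMem_Oprime hF' hends hyd hzd hyO (Finset.mem_sdiff.1 heF).1

/-- **Inside the `W`-world of `G − d` of the smaller assignment, `W`-connections survive
upwards.** -/
theorem conn_endsD_compl_assignX_mono_of_mem_M2 {p q r s d : V} (hr : d ≠ r) (hs : d ≠ s)
    {ρ : Config E} (hρ : ρ ∈ RepD ends p q r s d) {x x' : Finset (Finset V) × Finset E}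
    (hxx' : x ≤ x') (hx : x ∈ cubeP ends d r s ρ) (hx' : x' ∈ cubeP ends d r s ρ) {a b : V}
    (ha : a ∈ M2 (endsD ends d) r s (assignX ends x ρ))
    (hc : Conn (endsD ends d) (OneColourSwitch.compl (assignX ends x ρ)) a b) :
    Conn (endsD ends d) (OneColourSwitch.compl (assignX ends x' ρ)) a b := by
  obtain ⟨hT, hF⟩ := mem_cubeP.1 hx
  obtain ⟨hT', hF'⟩ := mem_cubeP.1 hx'
  refine conn_endsD_of_le_within_cluster ?_ hc
  intro e y z hends hyz hyd hzd hay haz hopen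
  have hyM : y ∈ M2 (endsD ends d) r s (assignX ends x ρ) := by
    rw [← K2_compl]
    rw [← K2_compl] at ha
    rcases mem_K2_iff.1 ha with h | h
    · exact mem_K2_iff.2 (Or.inl (conn_trans h hay))
    · exact mem_K2_iff.2 (Or.inr (conn_trans h hay))
  have hzM : z ∈ M2 (endsD ends d) r s (assignX ends x ρ) := by
    rw [← K2_compl]
    rw [← K2_compl] at ha
    rcases mem_K2_iff.1 ha with h | h
    · exact mem_K2_iff.2 (Or.inl (conn_trans h haz))
    · exact mem_K2_iff.2 (Or.inr (conn_trans h haz))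
  have hyO : y ∉ Oprime ends d r s ρ := not_mem_Oprime_of_mem_M2_endsD_assignX hr hs hρ hT hF hyM
  -- a vertex of the `W`-world of `x` is not in a block switched in between
  have hnot : ∀ w, w ∈ M2 (endsD ends d) r s (assignX ends x ρ) →
      w ∉ unionT x'.1 \ unionT x.1 := by
    intro w hw hw'
    have hwK := mem_K2_endsD_assignX_of_mem_sdiff' hr hs hρ hxx' hT' hF hw'
    have hD := DZero_endsD_assignX' hr hs hρ hT hF
    obtain ⟨hwT', _⟩ := Finset.mem_sdiff.1 hw'
    have hwA := unionT_subset_A0 (ends := endsD ends d) hT' hwT'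
    obtain ⟨_, hwr, hws⟩ := mem_A0.1 hwA
    exact hD w hwr hws hwK hw
  simp only [OneColourSwitch.compl] at hopen ⊢
  rw [← assignX_eq_of_le hxx' hT' ?_ ?_]
  · exact hopen
  · rintro ⟨w, hw, v, hwv⟩
    rw [hends, Sym2.eq_iff] at hwv
    rcases hwv with ⟨h1, _⟩ | ⟨_, h2⟩
    · rw [← h1] at hw
      exact hnot y hyM (Finset.mem_coe.1 hw)
    · rw [← h2] at hw
      exact hnot z hzM (Finset.mem_coe.1 hw)
  · intro heF
    exact not_mem_snd_of_notMem_Oprime hF' hends hyd hzd hyO (Finset.mem_sdiff.1 heF).1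

end WorldMono

section Terminals

variable [Fintype V] [DecidableEq V] [Fintype E] [DecidableEq E]

variable {ends : E → Sym2 V}

/-- **(M4′) A `Y`-connection from a terminal to `d` survives downwards.** -/
theorem conn_term_d_assignX_anti {p q r s d : V} (hr : d ≠ r) (hs : d ≠ s) {ρ : Config E}
    (hρ : ρ ∈ RepP ends p q r s d) {x x' : Finset (Finset V) × Finset E} (hxx' : x ≤ x')
    (hx : x ∈ cubeP ends d r s ρ) (hx' : x' ∈ cubeP ends d r s ρ) {t : V} (ht : t = r ∨ t = s)
    (hc : Conn ends (assignX ends x' ρ) t d) : Conn ends (assignX ends x ρ) t d := by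
  obtain ⟨hρD, _⟩ := mem_RepP.1 hρ
  obtain ⟨hT, hF⟩ := mem_cubeP.1 hx
  obtain ⟨hT', hF'⟩ := mem_cubeP.1 hx'
  have htd : t ≠ d := by
    rcases ht with rfl | rfl
    · exact hr.symm
    · exact hs.symm
  obtain ⟨e, u, hends, he, hcu⟩ := conn_d_decomp htd hc
  have htK : t ∈ K2 (endsD ends d) r s (assignX ends x' ρ) := by
    rcases ht with rfl | rfl
    · exact r_mem_K2 _ _ _
    · exact s_mem_K2 _ _ _
  have huK : u ∈ K2 (endsD ends d) r s (assignX ends x' ρ) := by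
    rcases mem_K2_iff.1 htK with h | h
    · exact mem_K2_iff.2 (Or.inl (conn_trans h hcu))
    · exact mem_K2_iff.2 (Or.inr (conn_trans h hcu))
  have hcu' : Conn (endsD ends d) (assignX ends x ρ) t u :=
    conn_endsD_assignX_anti_of_mem_K2 hr hs hρD hxx' hx hx' htK hcu
  have he' : assignX ends x ρ e = true := by
    by_cases hur : u = r ∨ u = s
    · have heT : e ∈ Tset ends d r s := mem_Tset.2 (by
        rcases hur with rfl | rfl
        · exact Or.inl hends
        · exact Or.inr hends)
      have hex' : e ∉ x'.2 := (assignX_Tset_eq_true_iff hρD hT' hr hs heT).1 he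
      exact (assignX_Tset_eq_true_iff hρD hT hr hs heT).2 (fun h => hex' (hxx'.2 h))
    · push Not at hur
      rcases mem_Oprime_or_block (ends := ends) (d := d) ρ hur.1 hur.2 with hu | ⟨C, hC, huC⟩
      · exact absurd hu (not_mem_Oprime_of_mem_K2_endsD_assignX hr hs hρD hT' hF' huK)
      · have hCx' : C ∉ x'.1 := by
          intro hCx'
          rw [K2_endsD_assignX' hr hs hρD hT' hF'] at huK
          exact huK.2 (Finset.mem_coe.2 (mem_unionT.2 ⟨C, hCx', huC⟩))
        rw [assignX_block_edge' hρD hT hF hr hs hC huC hends, if_neg (fun h => hCx' (hxx'.1 h))]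
        rw [assignX_block_edge' hρD hT' hF' hr hs hC huC hends, if_neg hCx'] at he
        exact he
  exact conn_trans (conn_of_conn_endsD hcu') (conn_symm (conn_of_openAdj ⟨e, he', hends⟩))

/-- **(M4″) A `W`-connection from a terminal to `d` survives upwards.** -/
theorem conn_term_d_compl_assignX_mono {p q r s d : V} (hr : d ≠ r) (hs : d ≠ s) {ρ : Config E}
    (hρ : ρ ∈ RepP ends p q r s d) {x x' : Finset (Finset V) × Finset E} (hxx' : x ≤ x')
    (hx : x ∈ cubeP ends d r s ρ) (hx' : x' ∈ cubeP ends d r s ρ) {t : V} (ht : t = r ∨ t = s)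
    (hc : Conn ends (OneColourSwitch.compl (assignX ends x ρ)) t d) :
    Conn ends (OneColourSwitch.compl (assignX ends x' ρ)) t d := by
  obtain ⟨hρD, _⟩ := mem_RepP.1 hρ
  obtain ⟨hT, hF⟩ := mem_cubeP.1 hx
  obtain ⟨hT', hF'⟩ := mem_cubeP.1 hx'
  have htd : t ≠ d := by
    rcases ht with rfl | rfl
    · exact hr.symm
    · exact hs.symm
  obtain ⟨e, u, hends, he, hcu⟩ := conn_d_decomp htd hc
  have htM : t ∈ M2 (endsD ends d) r s (assignX ends x ρ) := by
    rcases ht with rfl | rfl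
    · exact r_mem_M2 _ _ _
    · exact s_mem_M2 _ _ _
  have huM : u ∈ M2 (endsD ends d) r s (assignX ends x ρ) := by
    rcases mem_M2_iff.1 htM with h | h
    · exact mem_M2_iff.2 (Or.inl (conn_trans h hcu))
    · exact mem_M2_iff.2 (Or.inr (conn_trans h hcu))
  have hcu' : Conn (endsD ends d) (OneColourSwitch.compl (assignX ends x' ρ)) t u :=
    conn_endsD_compl_assignX_mono_of_mem_M2 hr hs hρD hxx' hx hx' htM hcu
  have he' : OneColourSwitch.compl (assignX ends x' ρ) e = true := by
    simp only [OneColourSwitch.compl, Bool.not_eq_true'] at he ⊢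
    by_cases hur : u = r ∨ u = s
    · have heT : e ∈ Tset ends d r s := mem_Tset.2 (by
        rcases hur with rfl | rfl
        · exact Or.inl hends
        · exact Or.inr hends)
      have hex : e ∈ x.2 := (assignX_Tset_eq_false_iff hρD hT hr hs heT).1 he
      exact (assignX_Tset_eq_false_iff hρD hT' hr hs heT).2 (hxx'.2 hex)
    · push Not at hur
      rcases mem_Oprime_or_block (ends := ends) (d := d) ρ hur.1 hur.2 with hu | ⟨C, hC, huC⟩
      · exact absurd hu (not_mem_Oprime_of_mem_M2_endsD_assignX hr hs hρD hT hF huM)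
      · have hCx : C ∈ x.1 := by
          rw [M2_endsD_assignX' hr hs hρD hT hF] at huM
          rcases huM with huM | huM
          · obtain ⟨_, hM', _⟩ := mem_RepD.1 hρD
            obtain ⟨hur', hus', _⟩ := block_vertex_ne hρD hC huC hr hs
            rcases hM' u huM with h | h
            · exact (hur' h).elim
            · exact (hus' h).elim
          · exact block_mem_of_mem_unionT hρD hT hC huC (Finset.mem_coe.1 huM)
        rw [assignX_block_edge' hρD hT' hF' hr hs hC huC hends, if_pos (hxx'.1 hCx)]
        rw [assignX_block_edge' hρD hT hF hr hs hC huC hends, if_pos hCx] at he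
        exact he
  exact conn_trans (conn_of_conn_endsD hcu') (conn_symm (conn_of_openAdj ⟨e, he', hends⟩))

/-- **`d ∈ K₂` decreases along the cube.** -/
theorem mem_K2_assignX_anti {p q r s d : V} (hr : d ≠ r) (hs : d ≠ s) {ρ : Config E}
    (hρ : ρ ∈ RepP ends p q r s d) {x x' : Finset (Finset V) × Finset E} (hxx' : x ≤ x')
    (hx : x ∈ cubeP ends d r s ρ) (hx' : x' ∈ cubeP ends d r s ρ)
    (hd : d ∈ K2 ends r s (assignX ends x' ρ)) : d ∈ K2 ends r s (assignX ends x ρ) := by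
  rcases mem_K2_iff.1 hd with h | h
  · exact mem_K2_iff.2 (Or.inl (conn_term_d_assignX_anti hr hs hρ hxx' hx hx' (Or.inl rfl) h))
  · exact mem_K2_iff.2 (Or.inr (conn_term_d_assignX_anti hr hs hρ hxx' hx hx' (Or.inr rfl) h))

/-- **`d ∈ M₂` increases along the cube.** -/
theorem mem_M2_assignX_mono {p q r s d : V} (hr : d ≠ r) (hs : d ≠ s) {ρ : Config E}
    (hρ : ρ ∈ RepP ends p q r s d) {x x' : Finset (Finset V) × Finset E} (hxx' : x ≤ x')
    (hx : x ∈ cubeP ends d r s ρ) (hx' : x' ∈ cubeP ends d r s ρ)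
    (hd : d ∈ M2 ends r s (assignX ends x ρ)) : d ∈ M2 ends r s (assignX ends x' ρ) := by
  rcases mem_M2_iff.1 hd with h | h
  · exact mem_M2_iff.2 (Or.inl (conn_term_d_compl_assignX_mono hr hs hρ hxx' hx hx' (Or.inl rfl) h))
  · exact mem_M2_iff.2 (Or.inr (conn_term_d_compl_assignX_mono hr hs hρ hxx' hx hx' (Or.inr rfl) h))

/-- **(M5′) `r ~_Y s` decreases along the cube.** -/
theorem conn_rs_assignX_anti' {p q r s d : V} (hr : d ≠ r) (hs : d ≠ s) {ρ : Config E}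
    (hρ : ρ ∈ RepP ends p q r s d) {x x' : Finset (Finset V) × Finset E} (hxx' : x ≤ x')
    (hx : x ∈ cubeP ends d r s ρ) (hx' : x' ∈ cubeP ends d r s ρ)
    (hc : Conn ends (assignX ends x' ρ) r s) : Conn ends (assignX ends x ρ) r s := by
  obtain ⟨hρD, _⟩ := mem_RepP.1 hρ
  by_cases h : Conn (endsD ends d) (assignX ends x' ρ) r s
  · exact conn_of_conn_endsD
      (conn_endsD_assignX_anti_of_mem_K2 hr hs hρD hxx' hx hx' (r_mem_K2 _ _ _) h)
  · have h1 : Conn ends (assignX ends x' ρ) r d := by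
      by_contra hn
      exact h (conn_endsD_of_not_conn hc hn)
    have h2 : Conn ends (assignX ends x' ρ) s d := by
      by_contra hn
      exact h (conn_symm (conn_endsD_of_not_conn (conn_symm hc) hn))
    exact conn_trans (conn_term_d_assignX_anti hr hs hρ hxx' hx hx' (Or.inl rfl) h1)
      (conn_symm (conn_term_d_assignX_anti hr hs hρ hxx' hx hx' (Or.inr rfl) h2))

/-- **(M5″) `r ~_W s` increases along the cube.** -/
theorem conn_rs_compl_assignX_mono' {p q r s d : V} (hr : d ≠ r) (hs : d ≠ s) {ρ : Config E}
    (hρ : ρ ∈ RepP ends p q r s d) {x x' : Finset (Finset V) × Finset E} (hxx' : x ≤ x')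
    (hx : x ∈ cubeP ends d r s ρ) (hx' : x' ∈ cubeP ends d r s ρ)
    (hc : Conn ends (OneColourSwitch.compl (assignX ends x ρ)) r s) :
    Conn ends (OneColourSwitch.compl (assignX ends x' ρ)) r s := by
  obtain ⟨hρD, _⟩ := mem_RepP.1 hρ
  by_cases h : Conn (endsD ends d) (OneColourSwitch.compl (assignX ends x ρ)) r s
  · exact conn_of_conn_endsD
      (conn_endsD_compl_assignX_mono_of_mem_M2 hr hs hρD hxx' hx hx' (r_mem_M2 _ _ _) h)
  · have h1 : Conn ends (OneColourSwitch.compl (assignX ends x ρ)) r d := by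
      by_contra hn
      exact h (conn_endsD_of_not_conn hc hn)
    have h2 : Conn ends (OneColourSwitch.compl (assignX ends x ρ)) s d := by
      by_contra hn
      exact h (conn_symm (conn_endsD_of_not_conn (conn_symm hc) hn))
    exact conn_trans (conn_term_d_compl_assignX_mono hr hs hρ hxx' hx hx' (Or.inl rfl) h1)
      (conn_symm (conn_term_d_compl_assignX_mono hr hs hρ hxx' hx hx' (Or.inr rfl) h2))

end Terminals

end NoPocket

end Summit.Ventures.PercRepro2
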